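import Literature.MathematicalPhysics.KineticTheory.InfiniteChainEnergyDensityMoments
import Literature.MathematicalPhysics.KineticTheory.InfiniteChainGoodSetSymmetries
import Literature.MathematicalPhysics.KineticTheory.FluctuationFoelnerPositivity
import HarnessLib

/-!
# Zero-wavenumber data of the infinite chain from a clustering hypothesis

Topic `Literature/MathematicalPhysics/KineticTheory` (companion of `ZeroWavenumberSpace`). For the
chain `P : OscillatorChain` (`U ≥ 0` measurable, `V` an even non-negative polynomial of degree `≥ 2`),
a dynamics `D` with carrier Buttà–Marchioro's good set `𝒳₀ = bmGood P` which is the IDENTITY OFF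
`𝒳₀` (the normal form of `OscillatorChain.exists_bmDynamics`), and a shift-invariant state `μ` with
BM's superstability estimate (2.3) preserved by `D`, we CONSTRUCT Doyon's hypothesis structure
`ZeroWavenumberData P D` with state `μ` and local observables
`𝒱 = span_ℝ {a ∘ τ_x ∘ φ_s : a ∈ {j₀, h₀}, x ∈ ℤ, s ∈ ℝ}`
from the SINGLE remaining analytic input, summable clustering of all pairs of GENERATORS
(`hclust : Integrable (x ↦ Cov_μ(a, b ∘ τ_x)) count` for `a, b` of the form `a₁ ∘ τ_y ∘ φ_s`,
`a₁ ∈ {j₀, h₀}`; it extends to the span by bilinearity of the covariance on `L²`, as in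
`FluctuationClusteringSpan`):
`exists_zeroWavenumberData_of_clustering`; under momentum-reversal invariance of `μ` the data has
`HasMomentumReversal`. All the other fields are supplied by the tree: square integrability
(`InfiniteChainCurrentMoments`, `InfiniteChainEnergyDensityMoments`), translation invariance
(`IsShiftInvariant.measurePreserving_chainShift`), positivity of the structure factor
(`FluctuationFoelnerPositivity`), and the EVERYWHERE symmetries of a flow that is the identity off the
translation- and reversal-invariant set `𝒳₀` (§1: `φ_t ∘ τ_x = τ_x ∘ φ_t`, `φ_t ∘ R = R ∘ φ_{-t}`,
`φ_s ∘ φ_t = φ_{s+t}`, `φ_0 = id` as identities of functions). Everything is proved; tagged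
`[folklore]`. No definitions, no named facts.
-/

noncomputable section

open MeasureTheory ProbabilityTheory Filter Set Function

namespace Literature.MathematicalPhysics.KineticTheory.HeatConduction

namespace InfiniteChainDynamics

variable {P : OscillatorChain} (D : InfiniteChainDynamics P)

/-! ### §1 Everywhere symmetries of a flow that is the identity off `𝒳₀` -/

/-- `τ_x σ ∈ 𝒳₀ ↔ σ ∈ 𝒳₀` (`U, V ≥ 0`). [folklore] -/
theorem _root_.Literature.MathematicalPhysics.KineticTheory.HeatConduction.OscillatorChain.chainShift_mem_bmGood_iff
    (hU0 : ∀ r, 0 ≤ P.U r) (hV0 : ∀ r, 0 ≤ P.V r) (x : ℤ) (σ : ChainConfig) :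
    chainShift x σ ∈ P.bmGood ↔ σ ∈ P.bmGood := by
  refine ⟨fun h => ?_, fun h => OscillatorChain.mapsTo_chainShift_bmGood hU0 hV0 x h⟩
  have e : chainShift (-x) (chainShift x σ) = σ := congrFun (chainShift.neg_comp x) σ
  rw [← e]
  exact OscillatorChain.mapsTo_chainShift_bmGood hU0 hV0 (-x) h

/-- **Homogeneity everywhere**: for a flow with carrier `𝒳₀` that is the identity off `𝒳₀`,
`φ_t (τ_x σ) = τ_x (φ_t σ)` for EVERY `σ` (`U, V ≥ 0`). [folklore] -/
theorem flow_chainShift_of_eq_id (hcar : D.carrier = P.bmGood)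
    (hid : ∀ (t : ℝ) (σ : ChainConfig), σ ∉ P.bmGood → D.flow t σ = σ) (hU0 : ∀ r, 0 ≤ P.U r)
    (hV0 : ∀ r, 0 ≤ P.V r) (t : ℝ) (x : ℤ) (σ : ChainConfig) :
    D.flow t (chainShift x σ) = chainShift x (D.flow t σ) := by
  by_cases hσ : σ ∈ P.bmGood
  · exact D.flow_chainShift_of_carrier_eq_bmGood hcar hU0 hV0 hσ t x
  · rw [hid t σ hσ, hid t _ (mt (OscillatorChain.chainShift_mem_bmGood_iff hU0 hV0 x σ).1 hσ)]

/-- **Reversibility everywhere**: `φ_t (R σ) = R (φ_{-t} σ)` for EVERY `σ`. [folklore] -/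
theorem flow_chainReversal_of_eq_id (hcar : D.carrier = P.bmGood)
    (hid : ∀ (t : ℝ) (σ : ChainConfig), σ ∉ P.bmGood → D.flow t σ = σ) (t : ℝ) (σ : ChainConfig) :
    D.flow t (chainReversal σ) = chainReversal (D.flow (-t) σ) := by
  by_cases hσ : σ ∈ P.bmGood
  · exact D.flow_chainReversal_of_carrier_eq_bmGood hcar hσ t
  · rw [hid t _ (mt (P.chainReversal_mem_bmGood_iff σ).1 hσ), hid (-t) σ hσ]

/-- **Group law everywhere**: `φ_{s+t} = φ_s ∘ φ_t` as functions. [folklore] -/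
theorem flow_add_of_eq_id (hcar : D.carrier = P.bmGood)
    (hid : ∀ (t : ℝ) (σ : ChainConfig), σ ∉ P.bmGood → D.flow t σ = σ) (s t : ℝ) (σ : ChainConfig) :
    D.flow (s + t) σ = D.flow s (D.flow t σ) := by
  by_cases hσ : σ ∈ P.bmGood
  · exact D.flow_add (hcar ▸ hσ) s t
  · rw [hid _ σ hσ, hid t σ hσ, hid s σ hσ]

/-- `φ_0 = id` as functions. [folklore] -/
theorem flow_zero_of_eq_id (hcar : D.carrier = P.bmGood)
    (hid : ∀ (t : ℝ) (σ : ChainConfig), σ ∉ P.bmGood → D.flow t σ = σ) (σ : ChainConfig) :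
    D.flow 0 σ = σ := by
  by_cases hσ : σ ∈ P.bmGood
  · exact D.flow_zero σ (hcar ▸ hσ)
  · exact hid 0 σ hσ

/-! ### §2 The zero-wavenumber data -/

/-- **Zero-wavenumber data of the chain from summable clustering.** Let `U ≥ 0` be measurable and
`V` an even non-negative polynomial of degree `≥ 2`; let `D` have carrier `𝒳₀` and be the identity
off `𝒳₀`; let `μ` be shift-invariant, satisfy BM's (2.3) and be preserved by `D`. Let
`𝒱 = span_ℝ {(a ∘ τ_x) ∘ φ_s : a ∈ {j₀, h₀}, x ∈ ℤ, s ∈ ℝ}`. If every pair of generators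
`(a ∘ τ_x) ∘ φ_s` has summable truncated correlations, `Integrable (x ↦ Cov_μ(a, b ∘ τ_x)) count`
(hence every pair of `𝒱`, by bilinearity), then there is a
`ZeroWavenumberData P D` with state `μ` and local observables `𝒱`; if moreover `μ ∘ R⁻¹ = μ` it has
momentum-reversal symmetry. [folklore] -/
theorem exists_zeroWavenumberData_of_clustering {s₂ : ℕ} (h₂ : 1 ≤ s₂) (hU0 : ∀ r, 0 ≤ P.U r)
    (hUm : Measurable P.U) (hV : OscillatorChain.IsEvenPolyOfDegree P.V s₂)
    (hcar : D.carrier = P.bmGood)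
    (hid : ∀ (t : ℝ) (σ : ChainConfig), σ ∉ P.bmGood → D.flow t σ = σ)
    {μ : Measure ChainConfig} (hS : IsShiftInvariant μ) (hss : P.HasSuperstabilityEstimate μ)
    (hD : D.PreservesMeasure μ)
    (hclust : ∀ a ∈ {b : ChainConfig → ℝ |
        ∃ a ∈ ({fun σ => P.bondCurrentZ σ 0, fun σ => P.energyDensityZ σ 0} : Set (ChainConfig → ℝ)),
          ∃ (x : ℤ) (s : ℝ), b = (a ∘ chainShift x) ∘ D.flow s},
      ∀ b ∈ {b : ChainConfig → ℝ |
        ∃ a ∈ ({fun σ => P.bondCurrentZ σ 0, fun σ => P.energyDensityZ σ 0} : Set (ChainConfig → ℝ)),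
          ∃ (x : ℤ) (s : ℝ), b = (a ∘ chainShift x) ∘ D.flow s},
      Integrable (fun x : ℤ => cov[a, b ∘ chainShift x; μ]) (Measure.count : Measure ℤ)) :
    ∃ Z : ZeroWavenumberData P D, Z.μ = μ ∧
      Z.localObs = Submodule.span ℝ {b : ChainConfig → ℝ |
        ∃ a ∈ ({fun σ => P.bondCurrentZ σ 0, fun σ => P.energyDensityZ σ 0} : Set (ChainConfig → ℝ)),
          ∃ (x : ℤ) (s : ℝ), b = (a ∘ chainShift x) ∘ D.flow s} ∧
      (μ.map momentumReversalZ = μ → Z.HasMomentumReversal) := by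
  haveI : IsProbabilityMeasure μ := hss.1
  have hV0 : ∀ r, 0 ≤ P.V r := hV.choose_spec.2.2
  have hVm : Measurable P.V := hV.continuous.measurable
  -- the generators and their span
  set G : Set (ChainConfig → ℝ) :=
    {fun σ => P.bondCurrentZ σ 0, fun σ => P.energyDensityZ σ 0} with hG
  set S₀ : Set (ChainConfig → ℝ) :=
    {b | ∃ a ∈ G, ∃ (x : ℤ) (s : ℝ), b = (a ∘ chainShift x) ∘ D.flow s} with hS₀
  set V₀ : Submodule ℝ (ChainConfig → ℝ) := Submodule.span ℝ S₀ with hV₀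
  -- everywhere symmetries
  have hcomm : ∀ (t : ℝ) (x : ℤ), D.flow t ∘ chainShift x = chainShift x ∘ D.flow t := fun t x =>
    funext fun σ => D.flow_chainShift_of_eq_id hcar hid hU0 hV0 t x σ
  have hadd : ∀ s t : ℝ, D.flow s ∘ D.flow t = D.flow (s + t) := fun s t =>
    funext fun σ => (D.flow_add_of_eq_id hcar hid s t σ).symm
  have hzero : D.flow 0 = id := funext fun σ => D.flow_zero_of_eq_id hcar hid σ
  -- stability of `S₀` under translations, the flow and the reversal
  have hS₀shift : ∀ y : ℤ, ∀ b ∈ S₀, b ∘ chainShift y ∈ S₀ := by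
    rintro y b ⟨a, ha, x, s, rfl⟩
    refine ⟨a, ha, x + y, s, ?_⟩
    funext σ
    simp only [comp_apply]
    rw [D.flow_chainShift_of_eq_id hcar hid hU0 hV0 s y σ, ← ShiftAction.apply_add]
  have hS₀flow : ∀ t : ℝ, ∀ b ∈ S₀, b ∘ D.flow t ∈ S₀ := by
    rintro t b ⟨a, ha, x, s, rfl⟩
    refine ⟨a, ha, x, s + t, ?_⟩
    rw [← hadd s t]
    rfl
  -- linear stability of the span under a precomposition
  have hspan_comp : ∀ g : ChainConfig → ChainConfig, (∀ b ∈ S₀, b ∘ g ∈ (V₀ : Set (ChainConfig → ℝ))) →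
      ∀ b ∈ V₀, b ∘ g ∈ V₀ := by
    intro g hg b hb
    have h1 := Submodule.apply_mem_span_image_of_mem_span (LinearMap.funLeft ℝ ℝ g) hb
    have h2 : Submodule.span ℝ (LinearMap.funLeft ℝ ℝ g '' S₀) ≤ V₀ :=
      Submodule.span_le.2 (by rintro _ ⟨b, hb, rfl⟩; exact hg b hb)
    exact h2 h1
  have hV₀shift : ∀ (y : ℤ) ⦃b : ChainConfig → ℝ⦄, b ∈ V₀ → b ∘ chainShift y ∈ V₀ := fun y b hb =>
    hspan_comp _ (fun b hb => Submodule.subset_span (hS₀shift y b hb)) b hb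
  have hV₀flow : ∀ (t : ℝ) ⦃b : ChainConfig → ℝ⦄, b ∈ V₀ → b ∘ D.flow t ∈ V₀ := fun t b hb =>
    hspan_comp _ (fun b hb => Submodule.subset_span (hS₀flow t b hb)) b hb
  -- square integrability
  have hmemS₀ : ∀ b ∈ S₀, MemLp b 2 μ := by
    rintro b ⟨a, ha, x, s, rfl⟩
    have h2 : (2 : ENNReal) ≠ ⊤ := ENNReal.ofNat_ne_top
    rcases ha with rfl | rfl
    · rw [P.bondCurrentZ_comp_chainShift x]
      exact (hss.memLp_bondCurrentZ h₂ hU0 hUm hV x h2).comp_measurePreserving (hD.2 s)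
    · rw [P.energyDensityZ_comp_chainShift x]
      exact hss.memLp_energyDensityZ_comp hU0 hV0 hUm hVm (hD.2 s) x h2
  have hmemV₀ : ∀ ⦃b : ChainConfig → ℝ⦄, b ∈ V₀ → MemLp b 2 μ := by
    intro b hb
    induction hb using Submodule.span_induction with
    | mem b hb => exact hmemS₀ b hb
    | zero => exact MemLp.zero
    | add b b' _ _ hb hb' => exact hb.add hb'
    | smul c b _ hb => exact hb.const_smul c
  -- the generators themselves
  have hgen : ∀ a ∈ G, a ∈ V₀ := by
    intro a ha
    refine Submodule.subset_span ⟨a, ha, 0, 0, ?_⟩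
    rw [hzero]
    funext σ
    simp only [comp_apply, id_eq, ShiftAction.apply_zero]
  have hj : (fun σ => P.bondCurrentZ σ 0) ∈ V₀ := hgen _ (by simp [hG])
  have hh : (fun σ => P.energyDensityZ σ 0) ∈ V₀ := hgen _ (by simp [hG])
  -- clustering of all pairs of the span, by bilinearity of the covariance on `L²`
  have hmemT : ∀ b ∈ V₀, ∀ x : ℤ, MemLp (b ∘ chainShift x) 2 μ := fun b hb x =>
    (hmemV₀ hb).comp_measurePreserving (hS.measurePreserving_chainShift x)
  have hclust1 : ∀ a ∈ S₀, ∀ b ∈ V₀,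
      Integrable (fun x : ℤ => cov[a, b ∘ chainShift x; μ]) (Measure.count : Measure ℤ) := by
    intro a ha b hb
    have haM : MemLp a 2 μ := hmemV₀ (Submodule.subset_span ha)
    induction hb using Submodule.span_induction with
    | mem b hb => exact hclust a ha b hb
    | zero =>
        have e : (fun x : ℤ => cov[a, (0 : ChainConfig → ℝ) ∘ chainShift x; μ]) = fun _ => 0 := by
          funext x
          exact covariance_const_right (0 : ℝ)
        rw [e]; exact integrable_zero _ _ _
    | add b b' hb hb' ih ih' =>
        have e : (fun x : ℤ => cov[a, (b + b') ∘ chainShift x; μ]) =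
            fun x => cov[a, b ∘ chainShift x; μ] + cov[a, b' ∘ chainShift x; μ] := by
          funext x
          exact covariance_add_right haM (hmemT b hb x) (hmemT b' hb' x)
        rw [e]; exact ih.add ih'
    | smul c b hb ih =>
        have e : (fun x : ℤ => cov[a, (c • b) ∘ chainShift x; μ]) =
            fun x => c * cov[a, b ∘ chainShift x; μ] := by
          funext x
          exact covariance_smul_right c
        rw [e]; exact ih.const_mul c
  have hclustV : ∀ a ∈ V₀, ∀ b ∈ V₀,
      Integrable (fun x : ℤ => cov[a, b ∘ chainShift x; μ]) (Measure.count : Measure ℤ) := by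
    intro a ha b hb
    induction ha using Submodule.span_induction with
    | mem a ha => exact hclust1 a ha b hb
    | zero =>
        have e : (fun x : ℤ => cov[(0 : ChainConfig → ℝ), b ∘ chainShift x; μ]) = fun _ => 0 := by
          funext x
          exact covariance_const_left (0 : ℝ)
        rw [e]; exact integrable_zero _ _ _
    | add a a' ha ha' ih ih' =>
        have e : (fun x : ℤ => cov[a + a', b ∘ chainShift x; μ]) =
            fun x => cov[a, b ∘ chainShift x; μ] + cov[a', b ∘ chainShift x; μ] := by
          funext x
          exact covariance_add_left (hmemV₀ ha) (hmemV₀ ha') (hmemT b hb x)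
        rw [e]; exact ih.add ih'
    | smul c a ha ih =>
        have e : (fun x : ℤ => cov[c • a, b ∘ chainShift x; μ]) =
            fun x => c * cov[a, b ∘ chainShift x; μ] := by
          funext x
          exact covariance_smul_left c
        rw [e]; exact ih.const_mul c
  -- the structure
  let F : FluctuationStructure (Measure.count : Measure ℤ) chainShift :=
    { μ := μ
      isProbabilityMeasure := hss.1
      measurePreserving_shift := hS.measurePreserving_chainShift
      localObs := V₀
      memLp_of_mem := hmemV₀
      comp_shift_mem := hV₀shift
      integrable_cov := fun a ha b hb => hclustV a ha b hb
      form_self_nonneg := fun a ha =>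
        integral_count_covariance_comp_shift_nonneg chainShift hS.measurePreserving_chainShift
          (hmemV₀ ha) (hclustV a ha a ha) }
  let Z : ZeroWavenumberData P D :=
    { toFluctuationStructure := F
      ae_mem_carrier := by rw [hcar]; simpa only [hcar] using hD.1
      measurePreserving_flow := hD.2
      flow_comm_shift := fun t x => Eventually.of_forall fun σ => congrFun (hcomm t x) σ
      comp_flow_mem := hV₀flow
      bondCurrent_mem := hj
      energyDensity_mem := hh }
  refine ⟨Z, rfl, rfl, fun hR => ?_⟩
  -- momentum reversal
  have hS₀rev : ∀ b ∈ S₀, b ∘ chainReversal ∈ (V₀ : Set (ChainConfig → ℝ)) := by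
    rintro b ⟨a, ha, x, s, rfl⟩
    have e : ((a ∘ chainShift x) ∘ D.flow s) ∘ chainReversal =
        ((a ∘ chainReversal) ∘ chainShift x) ∘ D.flow (-s) := by
      funext σ
      simp only [comp_apply]
      rw [D.flow_chainReversal_of_eq_id hcar hid s σ]
      exact congrArg a (congrFun (chainReversal_comp_chainShift x) (D.flow (-s) σ)).symm
    rw [e]
    rcases ha with rfl | rfl
    · have hodd : (fun σ => P.bondCurrentZ σ 0) ∘ chainReversal = -(fun σ => P.bondCurrentZ σ 0) := by
        funext σ; simp only [comp_apply, P.bondCurrentZ_chainReversal, Pi.neg_apply]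
      rw [hodd]
      have hmem : ((fun σ => P.bondCurrentZ σ 0) ∘ chainShift x) ∘ D.flow (-s) ∈ V₀ :=
        Submodule.subset_span ⟨_, by simp [hG], x, -s, rfl⟩
      have e2 : ((-fun σ => P.bondCurrentZ σ 0) ∘ chainShift x) ∘ D.flow (-s) =
          -(((fun σ => P.bondCurrentZ σ 0) ∘ chainShift x) ∘ D.flow (-s)) := rfl
      rw [e2]
      exact V₀.neg_mem hmem
    · have heven : (fun σ => P.energyDensityZ σ 0) ∘ chainReversal = fun σ => P.energyDensityZ σ 0 := by
        funext σ; simp only [comp_apply, P.energyDensityZ_chainReversal]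
      rw [heven]
      exact Submodule.subset_span ⟨_, by simp [hG], x, -s, rfl⟩
  exact
    { measurePreserving := by
        rw [← coe_momentumReversalZ]
        exact ⟨momentumReversalZ.measurable, hR⟩
      comp_mem := fun a ha => hspan_comp chainReversal hS₀rev a ha
      reversal_flow := fun t => Eventually.of_forall fun σ => by
        simp only [comp_apply]
        have h := D.flow_chainReversal_of_eq_id hcar hid (-t) σ
        rw [neg_neg] at h
        exact h.symm }

end InfiniteChainDynamics

end Literature.MathematicalPhysics.KineticTheory.HeatConduction

end
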